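import Summits.AtomisticToContinuum.Crystallization.Theses.HullExactificationCascade
import Summits.AtomisticToContinuum.Crystallization.Theorems.HullExactificationCascadeHcpLandscapeGapStubBoxMinimiser
import Summits.AtomisticToContinuum.Crystallization.Theorems.HullExactificationCascadeHcpLandscapeGapMasterOf
import Summits.AtomisticToContinuum.Crystallization.Theorems.HullExactificationCascadeHcpLandscapeGapStubBoundaryLayer

/-!
# Route HullExactificationCascade — crux B `HcpLandscapeGap` (stmt-AtomisticToContinuum-12087) from the cruxes of
# route HcpDefectCounting (line `birth`, composition core)

`HcpLandscapeGap_of_glue`: the crux B follows from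
* the rigidity of the box minimiser (registered stub `stub_boxMinimiserRigid`, hypothesis `hR`),
* the shell geometry at the enclosed parameters (registered stub `stub_shellGeometry`, hypothesis `hG`),
* the bulk floor `HcpDefectCounting.HcpBulkFloor` (stmt-14477, hypothesis `hF`) and
* the defect-counting coercivity `HcpDefectCounting.HcpDefectCoercivity` (stmt-14476, hypothesis `hK`),
using the LANDED pieces `stub_boxMinimiser` (P), `stub_boundaryLayer`, `master_of`.  The composition is the
registered skeleton's: `P → N → E → B` by the priced union bound `{η-bad} ⊆ {fcc-type} ∪ {¬fcc-type ∧ η-bad}` on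
the finite window (`priced_union_bound`, `HcpLandscapeGap_of_PNE`), with N and E obtained from `master_of` at the
rigid minimiser (fcc-type sites and `η`-bad sites are not `Good(4,θ)` by the shell geometry).  Once the two
geometric stubs land, `hR` and `hG` are discharged in a two-line corollary; what then remains is exactly
B ⇐ 14477 ∧ 14476.  [folklore bookkeeping]
-/

namespace Summit.AtomisticToContinuum.Crystallization.Theorems.HcpLandscapeGapBirth

/-- Bookkeeping behind the assembly: two priced lower bounds with the same bulk term, one pricing
the sites with property `F`, the other the sites with `¬F ∧ ¬G`, average to a lower bound pricing
all sites with `¬G` (union bound on a finite window). [folklore] -/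
theorem priced_union_bound {X : Type*} {S : Set X} {r F G : X → Prop}
    (hfin : ({y | y ∈ S ∧ r y} : Set X).Finite) {σ e κ₁ κ₂ C₁ C₂ L : ℝ}
    (hκ₁ : 0 < κ₁) (hκ₂ : 0 < κ₂)
    (h₁ : 2 * e * (({y | y ∈ S ∧ r y} : Set X).ncard : ℝ) +
        κ₁ * (({y | y ∈ S ∧ (r y ∧ F y)} : Set X).ncard : ℝ) - C₁ * (L + 1) ^ 2 ≤ σ)
    (h₂ : 2 * e * (({y | y ∈ S ∧ r y} : Set X).ncard : ℝ) +
        κ₂ * (({y | y ∈ S ∧ (r y ∧ (¬ F y ∧ ¬ G y))} : Set X).ncard : ℝ) - C₂ * (L + 1) ^ 2 ≤ σ) :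
    2 * e * (({y | y ∈ S ∧ r y} : Set X).ncard : ℝ) +
        min κ₁ κ₂ / 2 * (({y | y ∈ S ∧ (r y ∧ ¬ G y)} : Set X).ncard : ℝ) -
          (C₁ + C₂) / 2 * (L + 1) ^ 2 ≤ σ := by
  classical
  set A : Set X := {y | y ∈ S ∧ (r y ∧ F y)} with hA
  set B : Set X := {y | y ∈ S ∧ (r y ∧ (¬ F y ∧ ¬ G y))} with hB
  set D : Set X := {y | y ∈ S ∧ (r y ∧ ¬ G y)} with hD
  have hsub : D ⊆ A ∪ B := by
    intro y hy
    by_cases hF : F y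
    · exact Or.inl ⟨hy.1, hy.2.1, hF⟩
    · exact Or.inr ⟨hy.1, hy.2.1, hF, hy.2.2⟩
  have hABfin : (A ∪ B).Finite := by
    refine hfin.subset ?_
    intro y hy
    rcases hy with hy | hy
    · exact ⟨hy.1, hy.2.1⟩
    · exact ⟨hy.1, hy.2.1⟩
  have hDle : D.ncard ≤ A.ncard + B.ncard :=
    (Set.ncard_le_ncard hsub hABfin).trans (Set.ncard_union_le A B)
  have hDleR : (D.ncard : ℝ) ≤ (A.ncard : ℝ) + (B.ncard : ℝ) := by exact_mod_cast hDle
  have hm0 : 0 ≤ min κ₁ κ₂ / 2 := by positivity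
  have hA0 : (0 : ℝ) ≤ (A.ncard : ℝ) := Nat.cast_nonneg _
  have hB0 : (0 : ℝ) ≤ (B.ncard : ℝ) := Nat.cast_nonneg _
  have h3 : min κ₁ κ₂ / 2 * (D.ncard : ℝ) ≤ min κ₁ κ₂ / 2 * ((A.ncard : ℝ) + (B.ncard : ℝ)) :=
    mul_le_mul_of_nonneg_left hDleR hm0
  have h4 : min κ₁ κ₂ / 2 * (A.ncard : ℝ) ≤ κ₁ / 2 * (A.ncard : ℝ) :=
    mul_le_mul_of_nonneg_right (by linarith [min_le_left κ₁ κ₂]) hA0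
  have h5 : min κ₁ κ₂ / 2 * (B.ncard : ℝ) ≤ κ₂ / 2 * (B.ncard : ℝ) :=
    mul_le_mul_of_nonneg_right (by linarith [min_le_right κ₁ κ₂]) hB0
  nlinarith [h₁, h₂, h3, h4, h5]

/-- **Composition `P → N → E → B`** (the registered skeleton's assembly, conclusion = the body of the route decl
verbatim): the box-minimiser of P is the witness; for `δ, η > 0` the N- and E-inequalities are averaged through
`priced_union_bound` on the finite window `S ∩ B̄_L(c)`. [folklore] -/
theorem HcpLandscapeGap_of_PNE :
    (∃ a h : ℝ, ∃ ha : a ≠ 0, ∃ hh : h ≠ 0, (9 / 10 < a ∧ a < 1 ∧ |h - a * Real.sqrt (2 / 3)| ≤ a / 100) ∧ (∀ a' h' : ℝ, ∀ ha' : a' ≠ 0, ∀ hh' : h' ≠ 0, (9 / 10 < a' ∧ a' < 1 ∧ |h' - a' * Real.sqrt (2 / 3)| ≤ a' / 100) → (Literature.MathematicalPhysics.StatisticalMechanics.hcpPeriodicConfiguration ha hh).energyPerParticle Literature.MathematicalPhysics.StatisticalMechanics.lennardJones ≤ (Literature.MathematicalPhysics.StatisticalMechanics.hcpPeriodicConfiguration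 ha' hh').energyPerParticle Literature.MathematicalPhysics.StatisticalMechanics.lennardJones)) →
    (∀ a h : ℝ, ∀ ha : a ≠ 0, ∀ hh : h ≠ 0, (9 / 10 < a ∧ a < 1 ∧ |h - a * Real.sqrt (2 / 3)| ≤ a / 100) → (∀ a' h' : ℝ, ∀ ha' : a' ≠ 0, ∀ hh' : h' ≠ 0, (9 / 10 < a' ∧ a' < 1 ∧ |h' - a' * Real.sqrt (2 / 3)| ≤ a' / 100) → (Literature.MathematicalPhysics.StatisticalMechanics.hcpPeriodicConfiguration ha hh).energyPerParticle Literature.MathematicalPhysics.StatisticalMechanics.lennardJones ≤ (Literature.MathematicalPhysics.StatisticalMechanics.hcpPeriodicConfiguration ha' hh').energyPerParticle Literature.MathematicalPhysics.StatisticalMechanics.lennardJones) → ∀ δ : ℝ, 0 < δ → ∃ κ : ℝ, 0 < κ ∧ ∃ C : ℝ, ∀ S : Set (EuclideanSpace ℝ (Fin 3)), (∀ y ∈ S, ∀ z ∈ S, y ≠ z → δ ≤ dist y z) → (∀ y ∈ S, (let d : ℝ := sInf ((fun z => dist z y) '' (S \ {y})); let T : Set (EuclideanSpace ℝ (Fin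 3)) := {z : EuclideanSpace ℝ (Fin 3) | z ∈ S ∧ z ≠ y ∧ dist z y < 13 / 10 * d}; ∃ A : EuclideanSpace ℝ (Fin 3) →ₗᵢ[ℝ] EuclideanSpace ℝ (Fin 3), (∃ e : ↥T ≃ ↥Literature.Geometry.DiscreteGeometry.fccKissingPattern, ∀ t : ↥T, dist (d⁻¹ • ((t : EuclideanSpace ℝ (Fin 3)) - y)) (A ((e t : ↥Literature.Geometry.DiscreteGeometry.fccKissingPattern) : EuclideanSpace ℝ (Fin 3))) ≤ 1 / 20) ∨ (∃ e : ↥T ≃ ↥Literature.Geometry.DiscreteGeometry.hcpKissingPattern, ∀ t : ↥T, dist (d⁻¹ • ((t : EuclideanSpace ℝ (Fin 3)) - y)) (A ((e t : ↥Literature.Geometry.DiscreteGeometry.hcpKissingPattern) : EuclideanSpace ℝ (Fin 3))) ≤ 1 / 20))) → (∃ s : ℤ → ℤ, Literature.MathematicalPhysics.StatisticalMechanics.IsHaggSeq s ∧ ∃ Φ : EuclideanSpace ℝ (Fin 3) → EuclideanSpace ℝ (Fin 3), Set.BijOn Φ (Literature.MathematicalPhysics.StatisticalMechanics.barlowStacking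 1 (Real.sqrt (2 / 3)) s) S ∧ ∀ p ∈ Literature.MathematicalPhysics.StatisticalMechanics.barlowStacking 1 (Real.sqrt (2 / 3)) s, ∃ A : EuclideanSpace ℝ (Fin 3) →ₗᵢ[ℝ] EuclideanSpace ℝ (Fin 3), ∃ l : ℝ, 0 < l ∧ ∀ q ∈ Literature.MathematicalPhysics.StatisticalMechanics.barlowStacking 1 (Real.sqrt (2 / 3)) s, dist q p ≤ 1 → dist (Φ q) (Φ p + l • A (q - p)) ≤ 1 / 20 * l) → ∀ (c : EuclideanSpace ℝ (Fin 3)) (L : ℝ), 0 ≤ L → 2 * ((Literature.MathematicalPhysics.StatisticalMechanics.hcpPeriodicConfiguration ha hh).energyPerParticle Literature.MathematicalPhysics.StatisticalMechanics.lennardJones) * (({y : EuclideanSpace ℝ (Fin 3) | y ∈ S ∧ dist y c ≤ L} : Set (EuclideanSpace ℝ (Fin 3))).ncard : ℝ) + κ * (({y : EuclideanSpace ℝ (Fin 3) | y ∈ S ∧ dist y c ≤ L ∧ (let d : ℝ := sInf ((fun z => dist z y) '' (S \ {y})); let T : Set (EuclideanSpace ℝ (Fin 3)) := {z : EuclideanSpace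 ℝ (Fin 3) | z ∈ S ∧ z ≠ y ∧ dist z y < 13 / 10 * d}; ∃ A : EuclideanSpace ℝ (Fin 3) →ₗᵢ[ℝ] EuclideanSpace ℝ (Fin 3), ∃ e : ↥T ≃ ↥Literature.Geometry.DiscreteGeometry.fccKissingPattern, ∀ t : ↥T, dist (d⁻¹ • ((t : EuclideanSpace ℝ (Fin 3)) - y)) (A ((e t : ↥Literature.Geometry.DiscreteGeometry.fccKissingPattern) : EuclideanSpace ℝ (Fin 3))) ≤ 1 / 20)} : Set (EuclideanSpace ℝ (Fin 3))).ncard : ℝ) - C * (L + 1) ^ 2 ≤ (∑' y : ↥{y : EuclideanSpace ℝ (Fin 3) | y ∈ S ∧ dist y c ≤ L}, (∑' z : ↥{z : EuclideanSpace ℝ (Fin 3) | z ∈ S ∧ z ≠ (y : EuclideanSpace ℝ (Fin 3))}, Literature.MathematicalPhysics.StatisticalMechanics.lennardJones (dist (y : EuclideanSpace ℝ (Fin 3)) (z : EuclideanSpace ℝ (Fin 3)))))) →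
    (∀ a h : ℝ, ∀ ha : a ≠ 0, ∀ hh : h ≠ 0, (9 / 10 < a ∧ a < 1 ∧ |h - a * Real.sqrt (2 / 3)| ≤ a / 100) → (∀ a' h' : ℝ, ∀ ha' : a' ≠ 0, ∀ hh' : h' ≠ 0, (9 / 10 < a' ∧ a' < 1 ∧ |h' - a' * Real.sqrt (2 / 3)| ≤ a' / 100) → (Literature.MathematicalPhysics.StatisticalMechanics.hcpPeriodicConfiguration ha hh).energyPerParticle Literature.MathematicalPhysics.StatisticalMechanics.lennardJones ≤ (Literature.MathematicalPhysics.StatisticalMechanics.hcpPeriodicConfiguration ha' hh').energyPerParticle Literature.MathematicalPhysics.StatisticalMechanics.lennardJones) → ∀ δ : ℝ, 0 < δ → ∀ η : ℝ, 0 < η → ∃ κ : ℝ, 0 < κ ∧ ∃ C : ℝ, ∀ S : Set (EuclideanSpace ℝ (Fin 3)), (∀ y ∈ S, ∀ z ∈ S, y ≠ z → δ ≤ dist y z) → (∀ y ∈ S, (let d : ℝ := sInf ((fun z => dist z y) '' (S \ {y})); let T : Set (EuclideanSpace ℝ (Fin 3)) := {z : EuclideanSpace ℝ (Fin 3) | z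 ∈ S ∧ z ≠ y ∧ dist z y < 13 / 10 * d}; ∃ A : EuclideanSpace ℝ (Fin 3) →ₗᵢ[ℝ] EuclideanSpace ℝ (Fin 3), (∃ e : ↥T ≃ ↥Literature.Geometry.DiscreteGeometry.fccKissingPattern, ∀ t : ↥T, dist (d⁻¹ • ((t : EuclideanSpace ℝ (Fin 3)) - y)) (A ((e t : ↥Literature.Geometry.DiscreteGeometry.fccKissingPattern) : EuclideanSpace ℝ (Fin 3))) ≤ 1 / 20) ∨ (∃ e : ↥T ≃ ↥Literature.Geometry.DiscreteGeometry.hcpKissingPattern, ∀ t : ↥T, dist (d⁻¹ • ((t : EuclideanSpace ℝ (Fin 3)) - y)) (A ((e t : ↥Literature.Geometry.DiscreteGeometry.hcpKissingPattern) : EuclideanSpace ℝ (Fin 3))) ≤ 1 / 20))) → (∃ s : ℤ → ℤ, Literature.MathematicalPhysics.StatisticalMechanics.IsHaggSeq s ∧ ∃ Φ : EuclideanSpace ℝ (Fin 3) → EuclideanSpace ℝ (Fin 3), Set.BijOn Φ (Literature.MathematicalPhysics.StatisticalMechanics.barlowStacking 1 (Real.sqrt (2 / 3)) s) S ∧ ∀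 p ∈ Literature.MathematicalPhysics.StatisticalMechanics.barlowStacking 1 (Real.sqrt (2 / 3)) s, ∃ A : EuclideanSpace ℝ (Fin 3) →ₗᵢ[ℝ] EuclideanSpace ℝ (Fin 3), ∃ l : ℝ, 0 < l ∧ ∀ q ∈ Literature.MathematicalPhysics.StatisticalMechanics.barlowStacking 1 (Real.sqrt (2 / 3)) s, dist q p ≤ 1 → dist (Φ q) (Φ p + l • A (q - p)) ≤ 1 / 20 * l) → ∀ (c : EuclideanSpace ℝ (Fin 3)) (L : ℝ), 0 ≤ L → 2 * ((Literature.MathematicalPhysics.StatisticalMechanics.hcpPeriodicConfiguration ha hh).energyPerParticle Literature.MathematicalPhysics.StatisticalMechanics.lennardJones) * (({y : EuclideanSpace ℝ (Fin 3) | y ∈ S ∧ dist y c ≤ L} : Set (EuclideanSpace ℝ (Fin 3))).ncard : ℝ) + κ * (({y : EuclideanSpace ℝ (Fin 3) | y ∈ S ∧ dist y c ≤ L ∧ (¬ (let d : ℝ := sInf ((fun z => dist z y) '' (S \ {y})); let T : Set (EuclideanSpace ℝ (Fin 3)) := {z : EuclideanSpace ℝ (Fin 3) | z ∈ S ∧ z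 ≠ y ∧ dist z y < 13 / 10 * d}; ∃ A : EuclideanSpace ℝ (Fin 3) →ₗᵢ[ℝ] EuclideanSpace ℝ (Fin 3), ∃ e : ↥T ≃ ↥Literature.Geometry.DiscreteGeometry.fccKissingPattern, ∀ t : ↥T, dist (d⁻¹ • ((t : EuclideanSpace ℝ (Fin 3)) - y)) (A ((e t : ↥Literature.Geometry.DiscreteGeometry.fccKissingPattern) : EuclideanSpace ℝ (Fin 3))) ≤ 1 / 20) ∧ ¬ (let T : Set (EuclideanSpace ℝ (Fin 3)) := {z : EuclideanSpace ℝ (Fin 3) | z ∈ S ∧ z ≠ y ∧ dist z y < 13 / 10 * a}; let P : Set (EuclideanSpace ℝ (Fin 3)) := {p : EuclideanSpace ℝ (Fin 3) | p ∈ Literature.MathematicalPhysics.StatisticalMechanics.hcpStacking a h ∧ p ≠ 0 ∧ ‖p‖ < 13 / 10 * a}; ∃ A : EuclideanSpace ℝ (Fin 3) →ₗᵢ[ℝ] EuclideanSpace ℝ (Fin 3), ∃ e : ↥T ≃ ↥P, ∀ t : ↥T, dist ((t : EuclideanSpace ℝ (Fin 3)) - y) (A ((e t : ↥P) : EuclideanSpace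 ℝ (Fin 3))) ≤ η))} : Set (EuclideanSpace ℝ (Fin 3))).ncard : ℝ) - C * (L + 1) ^ 2 ≤ (∑' y : ↥{y : EuclideanSpace ℝ (Fin 3) | y ∈ S ∧ dist y c ≤ L}, (∑' z : ↥{z : EuclideanSpace ℝ (Fin 3) | z ∈ S ∧ z ≠ (y : EuclideanSpace ℝ (Fin 3))}, Literature.MathematicalPhysics.StatisticalMechanics.lennardJones (dist (y : EuclideanSpace ℝ (Fin 3)) (z : EuclideanSpace ℝ (Fin 3)))))) →
    (∃ a h : ℝ, ∃ ha : a ≠ 0, ∃ hh : h ≠ 0, (9 / 10 < a ∧ a < 1 ∧ |h - a * Real.sqrt (2 / 3)| ≤ a / 100) ∧ (∀ δ : ℝ, 0 < δ → ∀ η : ℝ, 0 < η → ∃ κ : ℝ, 0 < κ ∧ ∃ C : ℝ, ∀ S : Set (EuclideanSpace ℝ (Fin 3)), (∀ y ∈ S, ∀ z ∈ S, y ≠ z → δ ≤ dist y z) → (∀ y ∈ S, (let d : ℝ := sInf ((fun z => dist z y) '' (S \ {y})); let T : Set (EuclideanSpace ℝ (Fin 3)) := {z : EuclideanSpace ℝ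 (Fin 3) | z ∈ S ∧ z ≠ y ∧ dist z y < 13 / 10 * d}; ∃ A : EuclideanSpace ℝ (Fin 3) →ₗᵢ[ℝ] EuclideanSpace ℝ (Fin 3), (∃ e : ↥T ≃ ↥Literature.Geometry.DiscreteGeometry.fccKissingPattern, ∀ t : ↥T, dist (d⁻¹ • ((t : EuclideanSpace ℝ (Fin 3)) - y)) (A ((e t : ↥Literature.Geometry.DiscreteGeometry.fccKissingPattern) : EuclideanSpace ℝ (Fin 3))) ≤ 1 / 20) ∨ (∃ e : ↥T ≃ ↥Literature.Geometry.DiscreteGeometry.hcpKissingPattern, ∀ t : ↥T, dist (d⁻¹ • ((t : EuclideanSpace ℝ (Fin 3)) - y)) (A ((e t : ↥Literature.Geometry.DiscreteGeometry.hcpKissingPattern) : EuclideanSpace ℝ (Fin 3))) ≤ 1 / 20))) → (∃ s : ℤ → ℤ, Literature.MathematicalPhysics.StatisticalMechanics.IsHaggSeq s ∧ ∃ Φ : EuclideanSpace ℝ (Fin 3) → EuclideanSpace ℝ (Fin 3), Set.BijOn Φ (Literature.MathematicalPhysics.StatisticalMechanics.barlowStacking 1 (Real.sqrt (2 / 3))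 s) S ∧ ∀ p ∈ Literature.MathematicalPhysics.StatisticalMechanics.barlowStacking 1 (Real.sqrt (2 / 3)) s, ∃ A : EuclideanSpace ℝ (Fin 3) →ₗᵢ[ℝ] EuclideanSpace ℝ (Fin 3), ∃ l : ℝ, 0 < l ∧ ∀ q ∈ Literature.MathematicalPhysics.StatisticalMechanics.barlowStacking 1 (Real.sqrt (2 / 3)) s, dist q p ≤ 1 → dist (Φ q) (Φ p + l • A (q - p)) ≤ 1 / 20 * l) → ∀ (c : EuclideanSpace ℝ (Fin 3)) (L : ℝ), 0 ≤ L → 2 * ((Literature.MathematicalPhysics.StatisticalMechanics.hcpPeriodicConfiguration ha hh).energyPerParticle Literature.MathematicalPhysics.StatisticalMechanics.lennardJones) * (({y : EuclideanSpace ℝ (Fin 3) | y ∈ S ∧ dist y c ≤ L} : Set (EuclideanSpace ℝ (Fin 3))).ncard : ℝ) + κ * (({y : EuclideanSpace ℝ (Fin 3) | y ∈ S ∧ dist y c ≤ L ∧ ¬ (let T : Set (EuclideanSpace ℝ (Fin 3)) := {z : EuclideanSpace ℝ (Fin 3) | z ∈ S ∧ z ≠ y ∧ dist z y < 13 / 10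 * a}; let P : Set (EuclideanSpace ℝ (Fin 3)) := {p : EuclideanSpace ℝ (Fin 3) | p ∈ Literature.MathematicalPhysics.StatisticalMechanics.hcpStacking a h ∧ p ≠ 0 ∧ ‖p‖ < 13 / 10 * a}; ∃ A : EuclideanSpace ℝ (Fin 3) →ₗᵢ[ℝ] EuclideanSpace ℝ (Fin 3), ∃ e : ↥T ≃ ↥P, ∀ t : ↥T, dist ((t : EuclideanSpace ℝ (Fin 3)) - y) (A ((e t : ↥P) : EuclideanSpace ℝ (Fin 3))) ≤ η)} : Set (EuclideanSpace ℝ (Fin 3))).ncard : ℝ) - C * (L + 1) ^ 2 ≤ (∑' y : ↥{y : EuclideanSpace ℝ (Fin 3) | y ∈ S ∧ dist y c ≤ L}, (∑' z : ↥{z : EuclideanSpace ℝ (Fin 3) | z ∈ S ∧ z ≠ (y : EuclideanSpace ℝ (Fin 3))}, Literature.MathematicalPhysics.StatisticalMechanics.lennardJones (dist (y : EuclideanSpace ℝ (Fin 3)) (z : EuclideanSpace ℝ (Fin 3))))))) := by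
  intro hP hN hE
  obtain ⟨a, h, ha, hh, hbox, hmin⟩ := hP
  refine ⟨a, h, ha, hh, hbox, ?_⟩
  intro δ hδ η hη
  obtain ⟨κ₁, hκ₁, C₁, h₁⟩ := hN a h ha hh hbox hmin δ hδ
  obtain ⟨κ₂, hκ₂, C₂, h₂⟩ := hE a h ha hh hbox hmin δ hδ η hη
  refine ⟨min κ₁ κ₂ / 2, by positivity, (C₁ + C₂) / 2, ?_⟩
  intro S hsep hgood htempl c L hL
  have i₁ := h₁ S hsep hgood htempl c L hL
  have i₂ := h₂ S hsep hgood htempl c L hL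
  have hfin : ({y : EuclideanSpace ℝ (Fin 3) | y ∈ S ∧ dist y c ≤ L} : Set (EuclideanSpace ℝ (Fin 3))).Finite :=
    Literature.MathematicalPhysics.StatisticalMechanics.finite_of_forall_le_dist_of_subset_closedBall hδ
      (fun p hp q hq hpq => hsep p hp.1 q hq.1 hpq) (c := c) (R := L)
      (fun p hp => Metric.mem_closedBall.2 hp.2)
  exact priced_union_bound hfin hκ₁ hκ₂ i₁ i₂

/-- **N from the glue**: at a box-minimiser, fcc-type sites are priced — rigidity puts the minimiser at the enclosed
global minimiser, the shell geometry says fcc-type sites are not `Good(4,θ)`, and `master_of` prices those.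
[folklore] -/
theorem stackingFaultPrice_of_glue (hR : ∀ a h : ℝ, ∀ ha : a ≠ 0, ∀ hh : h ≠ 0, (9 / 10 < a ∧ a < 1 ∧ |h - a * Real.sqrt (2 / 3)| ≤ a / 100) → (∀ a' h' : ℝ, ∀ ha' : a' ≠ 0, ∀ hh' : h' ≠ 0, (9 / 10 < a' ∧ a' < 1 ∧ |h' - a' * Real.sqrt (2 / 3)| ≤ a' / 100) → (Literature.MathematicalPhysics.StatisticalMechanics.hcpPeriodicConfiguration ha hh).energyPerParticle Literature.MathematicalPhysics.StatisticalMechanics.lennardJones ≤ (Literature.MathematicalPhysics.StatisticalMechanics.hcpPeriodicConfiguration ha' hh').energyPerParticle Literature.MathematicalPhysics.StatisticalMechanics.lennardJones) → (|a - 97129 / 100000| ≤ 1 / 10000 ∧ |h - 79294 / 100000| ≤ 1 / 10000) ∧ (∀ a' h' : ℝ, ∀ ha' : a' ≠ 0, ∀ hh' : h' ≠ 0, 0 < a' → 0 < h' → (Literature.MathematicalPhysics.StatisticalMechanics.hcpPeriodicConfiguration ha hh).energyPerParticle Literature.MathematicalPhysics.StatisticalMechanics.lennardJones ≤ (Literature.MathematicalPhysics.StatisticalMechanics.hcpPeriodicConfiguration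 ha' hh').energyPerParticle Literature.MathematicalPhysics.StatisticalMechanics.lennardJones)) (hG : ∀ a h : ℝ, ∀ ha : a ≠ 0, ∀ hh : h ≠ 0, |a - 97129 / 100000| ≤ 1 / 10000 → |h - 79294 / 100000| ≤ 1 / 10000 → ∀ δ : ℝ, 0 < δ → ∀ η : ℝ, 0 < η → ∃ θ : ℝ, 0 < θ ∧ ∀ S : Set (EuclideanSpace ℝ (Fin 3)), (∀ y ∈ S, ∀ z ∈ S, y ≠ z → δ ≤ dist y z) → ∀ y ∈ S, (∃ A : EuclideanSpace ℝ (Fin 3) →ₗᵢ[ℝ] EuclideanSpace ℝ (Fin 3), (∀ p ∈ (Literature.MathematicalPhysics.StatisticalMechanics.hcpPeriodicConfiguration ha hh).points, ‖p‖ ≤ 4 → ∃ z ∈ S, dist z (y + A p) ≤ θ) ∧ (∀ z ∈ S, dist z y ≤ 4 → ∃ p ∈ (Literature.MathematicalPhysics.StatisticalMechanics.hcpPeriodicConfiguration ha hh).points, dist z (y + A p) ≤ θ)) → (let T : Set (EuclideanSpace ℝ (Fin 3)) := {z : EuclideanSpace ℝ (Fin 3) | z ∈ S ∧ z ≠ y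 ∧ dist z y < 13 / 10 * a}; let P : Set (EuclideanSpace ℝ (Fin 3)) := {p : EuclideanSpace ℝ (Fin 3) | p ∈ Literature.MathematicalPhysics.StatisticalMechanics.hcpStacking a h ∧ p ≠ 0 ∧ ‖p‖ < 13 / 10 * a}; ∃ A : EuclideanSpace ℝ (Fin 3) →ₗᵢ[ℝ] EuclideanSpace ℝ (Fin 3), ∃ e : ↥T ≃ ↥P, ∀ t : ↥T, dist ((t : EuclideanSpace ℝ (Fin 3)) - y) (A ((e t : ↥P) : EuclideanSpace ℝ (Fin 3))) ≤ η) ∧ ¬ (let d : ℝ := sInf ((fun z => dist z y) '' (S \ {y})); let T : Set (EuclideanSpace ℝ (Fin 3)) := {z : EuclideanSpace ℝ (Fin 3) | z ∈ S ∧ z ≠ y ∧ dist z y < 13 / 10 * d}; ∃ A : EuclideanSpace ℝ (Fin 3) →ₗᵢ[ℝ] EuclideanSpace ℝ (Fin 3), ∃ e : ↥T ≃ ↥Literature.Geometry.DiscreteGeometry.fccKissingPattern, ∀ t : ↥T, dist (d⁻¹ • ((t : EuclideanSpace ℝ (Fin 3)) - y)) (A ((e t : ↥Literature.Geometry.DiscreteGeometry.fccKissingPattern)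 : EuclideanSpace ℝ (Fin 3))) ≤ 1 / 20)) (hF : Summit.AtomisticToContinuum.Crystallization.Theses.HcpDefectCounting.HcpBulkFloor) (hK : Summit.AtomisticToContinuum.Crystallization.Theses.HcpDefectCounting.HcpDefectCoercivity) :
    ∀ a h : ℝ, ∀ ha : a ≠ 0, ∀ hh : h ≠ 0, (9 / 10 < a ∧ a < 1 ∧ |h - a * Real.sqrt (2 / 3)| ≤ a / 100) → (∀ a' h' : ℝ, ∀ ha' : a' ≠ 0, ∀ hh' : h' ≠ 0, (9 / 10 < a' ∧ a' < 1 ∧ |h' - a' * Real.sqrt (2 / 3)| ≤ a' / 100) → (Literature.MathematicalPhysics.StatisticalMechanics.hcpPeriodicConfiguration ha hh).energyPerParticle Literature.MathematicalPhysics.StatisticalMechanics.lennardJones ≤ (Literature.MathematicalPhysics.StatisticalMechanics.hcpPeriodicConfiguration ha' hh').energyPerParticle Literature.MathematicalPhysics.StatisticalMechanics.lennardJones) → ∀ δ : ℝ, 0 < δ → ∃ κ : ℝ, 0 < κ ∧ ∃ C : ℝ, ∀ S : Set (EuclideanSpace ℝ (Fin 3)), (∀ y ∈ S, ∀ z ∈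 S, y ≠ z → δ ≤ dist y z) → (∀ y ∈ S, (let d : ℝ := sInf ((fun z => dist z y) '' (S \ {y})); let T : Set (EuclideanSpace ℝ (Fin 3)) := {z : EuclideanSpace ℝ (Fin 3) | z ∈ S ∧ z ≠ y ∧ dist z y < 13 / 10 * d}; ∃ A : EuclideanSpace ℝ (Fin 3) →ₗᵢ[ℝ] EuclideanSpace ℝ (Fin 3), (∃ e : ↥T ≃ ↥Literature.Geometry.DiscreteGeometry.fccKissingPattern, ∀ t : ↥T, dist (d⁻¹ • ((t : EuclideanSpace ℝ (Fin 3)) - y)) (A ((e t : ↥Literature.Geometry.DiscreteGeometry.fccKissingPattern) : EuclideanSpace ℝ (Fin 3))) ≤ 1 / 20) ∨ (∃ e : ↥T ≃ ↥Literature.Geometry.DiscreteGeometry.hcpKissingPattern, ∀ t : ↥T, dist (d⁻¹ • ((t : EuclideanSpace ℝ (Fin 3)) - y)) (A ((e t : ↥Literature.Geometry.DiscreteGeometry.hcpKissingPattern) : EuclideanSpace ℝ (Fin 3))) ≤ 1 / 20))) → (∃ s : ℤ → ℤ, Literature.MathematicalPhysics.StatisticalMechanics.IsHaggSeq s ∧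 ∃ Φ : EuclideanSpace ℝ (Fin 3) → EuclideanSpace ℝ (Fin 3), Set.BijOn Φ (Literature.MathematicalPhysics.StatisticalMechanics.barlowStacking 1 (Real.sqrt (2 / 3)) s) S ∧ ∀ p ∈ Literature.MathematicalPhysics.StatisticalMechanics.barlowStacking 1 (Real.sqrt (2 / 3)) s, ∃ A : EuclideanSpace ℝ (Fin 3) →ₗᵢ[ℝ] EuclideanSpace ℝ (Fin 3), ∃ l : ℝ, 0 < l ∧ ∀ q ∈ Literature.MathematicalPhysics.StatisticalMechanics.barlowStacking 1 (Real.sqrt (2 / 3)) s, dist q p ≤ 1 → dist (Φ q) (Φ p + l • A (q - p)) ≤ 1 / 20 * l) → ∀ (c : EuclideanSpace ℝ (Fin 3)) (L : ℝ), 0 ≤ L → 2 * ((Literature.MathematicalPhysics.StatisticalMechanics.hcpPeriodicConfiguration ha hh).energyPerParticle Literature.MathematicalPhysics.StatisticalMechanics.lennardJones) * (({y : EuclideanSpace ℝ (Fin 3) | y ∈ S ∧ dist y c ≤ L} : Set (EuclideanSpace ℝ (Fin 3))).ncard : ℝ) + κ * (({y : EuclideanSpace ℝ (Fin 3) | y ∈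 S ∧ dist y c ≤ L ∧ (let d : ℝ := sInf ((fun z => dist z y) '' (S \ {y})); let T : Set (EuclideanSpace ℝ (Fin 3)) := {z : EuclideanSpace ℝ (Fin 3) | z ∈ S ∧ z ≠ y ∧ dist z y < 13 / 10 * d}; ∃ A : EuclideanSpace ℝ (Fin 3) →ₗᵢ[ℝ] EuclideanSpace ℝ (Fin 3), ∃ e : ↥T ≃ ↥Literature.Geometry.DiscreteGeometry.fccKissingPattern, ∀ t : ↥T, dist (d⁻¹ • ((t : EuclideanSpace ℝ (Fin 3)) - y)) (A ((e t : ↥Literature.Geometry.DiscreteGeometry.fccKissingPattern) : EuclideanSpace ℝ (Fin 3))) ≤ 1 / 20)} : Set (EuclideanSpace ℝ (Fin 3))).ncard : ℝ) - C * (L + 1) ^ 2 ≤ (∑' y : ↥{y : EuclideanSpace ℝ (Fin 3) | y ∈ S ∧ dist y c ≤ L}, (∑' z : ↥{z : EuclideanSpace ℝ (Fin 3) | z ∈ S ∧ z ≠ (y : EuclideanSpace ℝ (Fin 3))}, Literature.MathematicalPhysics.StatisticalMechanics.lennardJones (dist (y : EuclideanSpace ℝ (Fin 3)) (z : EuclideanSpace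 ℝ (Fin 3))))) := by
  intro a h ha hh hbox hmin δ hδ
  obtain ⟨henc, hglob⟩ := hR a h ha hh hbox hmin
  obtain ⟨θ, hθ, hgeo⟩ := hG a h ha hh henc.1 henc.2 δ hδ 1 one_pos
  obtain ⟨κ, hκ, C, hC⟩ := master_of stub_boundaryLayer hF hK a h ha hh henc hglob δ hδ θ hθ
    (fun S y => (let d : ℝ := sInf ((fun z => dist z y) '' (S \ {y})); let T : Set (EuclideanSpace ℝ (Fin 3)) := {z : EuclideanSpace ℝ (Fin 3) | z ∈ S ∧ z ≠ y ∧ dist z y < 13 / 10 * d}; ∃ A : EuclideanSpace ℝ (Fin 3) →ₗᵢ[ℝ] EuclideanSpace ℝ (Fin 3), ∃ e : ↥T ≃ ↥Literature.Geometry.DiscreteGeometry.fccKissingPattern, ∀ t : ↥T, dist (d⁻¹ • ((t : EuclideanSpace ℝ (Fin 3)) - y)) (A ((e t : ↥Literature.Geometry.DiscreteGeometry.fccKissingPattern) : EuclideanSpace ℝ (Fin 3))) ≤ 1 / 20))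
    (fun S hS y hy hGd => (hgeo S hS y hy hGd).2)
  refine ⟨κ, hκ, C, ?_⟩
  intro S hsep _hgood _htempl c L hL
  exact hC S hsep c L hL

/-- **E from the glue**: at a box-minimiser, `η`-bad sites (a fortiori the non-fcc-type `η`-bad ones) are priced —
`Good(4,θ)` sites are `η`-good by the shell geometry, and `master_of` prices the others. [folklore] -/
theorem elasticCoercivity_of_glue (hR : ∀ a h : ℝ, ∀ ha : a ≠ 0, ∀ hh : h ≠ 0, (9 / 10 < a ∧ a < 1 ∧ |h - a * Real.sqrt (2 / 3)| ≤ a / 100) → (∀ a' h' : ℝ, ∀ ha' : a' ≠ 0, ∀ hh' : h' ≠ 0, (9 / 10 < a' ∧ a' < 1 ∧ |h' - a' * Real.sqrt (2 / 3)| ≤ a' / 100) → (Literature.MathematicalPhysics.StatisticalMechanics.hcpPeriodicConfiguration ha hh).energyPerParticle Literature.MathematicalPhysics.StatisticalMechanics.lennardJones ≤ (Literature.MathematicalPhysics.StatisticalMechanics.hcpPeriodicConfiguration ha' hh').energyPerParticle Literature.MathematicalPhysics.StatisticalMechanics.lennardJones) → (|a - 97129 / 100000| ≤ 1 / 10000 ∧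 |h - 79294 / 100000| ≤ 1 / 10000) ∧ (∀ a' h' : ℝ, ∀ ha' : a' ≠ 0, ∀ hh' : h' ≠ 0, 0 < a' → 0 < h' → (Literature.MathematicalPhysics.StatisticalMechanics.hcpPeriodicConfiguration ha hh).energyPerParticle Literature.MathematicalPhysics.StatisticalMechanics.lennardJones ≤ (Literature.MathematicalPhysics.StatisticalMechanics.hcpPeriodicConfiguration ha' hh').energyPerParticle Literature.MathematicalPhysics.StatisticalMechanics.lennardJones)) (hG : ∀ a h : ℝ, ∀ ha : a ≠ 0, ∀ hh : h ≠ 0, |a - 97129 / 100000| ≤ 1 / 10000 → |h - 79294 / 100000| ≤ 1 / 10000 → ∀ δ : ℝ, 0 < δ → ∀ η : ℝ, 0 < η → ∃ θ : ℝ, 0 < θ ∧ ∀ S : Set (EuclideanSpace ℝ (Fin 3)), (∀ y ∈ S, ∀ z ∈ S, y ≠ z → δ ≤ dist y z) → ∀ y ∈ S, (∃ A : EuclideanSpace ℝ (Fin 3) →ₗᵢ[ℝ] EuclideanSpace ℝ (Fin 3), (∀ p ∈ (Literature.MathematicalPhysics.StatisticalMechanics.hcpPeriodicConfiguration ha hh).points,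 ‖p‖ ≤ 4 → ∃ z ∈ S, dist z (y + A p) ≤ θ) ∧ (∀ z ∈ S, dist z y ≤ 4 → ∃ p ∈ (Literature.MathematicalPhysics.StatisticalMechanics.hcpPeriodicConfiguration ha hh).points, dist z (y + A p) ≤ θ)) → (let T : Set (EuclideanSpace ℝ (Fin 3)) := {z : EuclideanSpace ℝ (Fin 3) | z ∈ S ∧ z ≠ y ∧ dist z y < 13 / 10 * a}; let P : Set (EuclideanSpace ℝ (Fin 3)) := {p : EuclideanSpace ℝ (Fin 3) | p ∈ Literature.MathematicalPhysics.StatisticalMechanics.hcpStacking a h ∧ p ≠ 0 ∧ ‖p‖ < 13 / 10 * a}; ∃ A : EuclideanSpace ℝ (Fin 3) →ₗᵢ[ℝ] EuclideanSpace ℝ (Fin 3), ∃ e : ↥T ≃ ↥P, ∀ t : ↥T, dist ((t : EuclideanSpace ℝ (Fin 3)) - y) (A ((e t : ↥P) : EuclideanSpace ℝ (Fin 3))) ≤ η) ∧ ¬ (let d : ℝ := sInf ((fun z => dist z y) '' (S \ {y})); let T : Set (EuclideanSpace ℝ (Fin 3)) := {z : EuclideanSpace ℝ (Fin 3) | z ∈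 S ∧ z ≠ y ∧ dist z y < 13 / 10 * d}; ∃ A : EuclideanSpace ℝ (Fin 3) →ₗᵢ[ℝ] EuclideanSpace ℝ (Fin 3), ∃ e : ↥T ≃ ↥Literature.Geometry.DiscreteGeometry.fccKissingPattern, ∀ t : ↥T, dist (d⁻¹ • ((t : EuclideanSpace ℝ (Fin 3)) - y)) (A ((e t : ↥Literature.Geometry.DiscreteGeometry.fccKissingPattern) : EuclideanSpace ℝ (Fin 3))) ≤ 1 / 20)) (hF : Summit.AtomisticToContinuum.Crystallization.Theses.HcpDefectCounting.HcpBulkFloor) (hK : Summit.AtomisticToContinuum.Crystallization.Theses.HcpDefectCounting.HcpDefectCoercivity) :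
    ∀ a h : ℝ, ∀ ha : a ≠ 0, ∀ hh : h ≠ 0, (9 / 10 < a ∧ a < 1 ∧ |h - a * Real.sqrt (2 / 3)| ≤ a / 100) → (∀ a' h' : ℝ, ∀ ha' : a' ≠ 0, ∀ hh' : h' ≠ 0, (9 / 10 < a' ∧ a' < 1 ∧ |h' - a' * Real.sqrt (2 / 3)| ≤ a' / 100) → (Literature.MathematicalPhysics.StatisticalMechanics.hcpPeriodicConfiguration ha hh).energyPerParticle Literature.MathematicalPhysics.StatisticalMechanics.lennardJones ≤ (Literature.MathematicalPhysics.StatisticalMechanics.hcpPeriodicConfiguration ha' hh').energyPerParticle Literature.MathematicalPhysics.StatisticalMechanics.lennardJones) → ∀ δ : ℝ, 0 < δ → ∀ η : ℝ, 0 < η → ∃ κ : ℝ, 0 < κ ∧ ∃ C : ℝ, ∀ S : Set (EuclideanSpace ℝ (Fin 3)), (∀ y ∈ S, ∀ z ∈ S, y ≠ z → δ ≤ dist y z) → (∀ y ∈ S, (let d : ℝ := sInf ((fun z => dist z y) '' (S \ {y})); let T : Set (EuclideanSpace ℝ (Fin 3)) := {z : EuclideanSpace ℝ (Fin 3) | z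 ∈ S ∧ z ≠ y ∧ dist z y < 13 / 10 * d}; ∃ A : EuclideanSpace ℝ (Fin 3) →ₗᵢ[ℝ] EuclideanSpace ℝ (Fin 3), (∃ e : ↥T ≃ ↥Literature.Geometry.DiscreteGeometry.fccKissingPattern, ∀ t : ↥T, dist (d⁻¹ • ((t : EuclideanSpace ℝ (Fin 3)) - y)) (A ((e t : ↥Literature.Geometry.DiscreteGeometry.fccKissingPattern) : EuclideanSpace ℝ (Fin 3))) ≤ 1 / 20) ∨ (∃ e : ↥T ≃ ↥Literature.Geometry.DiscreteGeometry.hcpKissingPattern, ∀ t : ↥T, dist (d⁻¹ • ((t : EuclideanSpace ℝ (Fin 3)) - y)) (A ((e t : ↥Literature.Geometry.DiscreteGeometry.hcpKissingPattern) : EuclideanSpace ℝ (Fin 3))) ≤ 1 / 20))) → (∃ s : ℤ → ℤ, Literature.MathematicalPhysics.StatisticalMechanics.IsHaggSeq s ∧ ∃ Φ : EuclideanSpace ℝ (Fin 3) → EuclideanSpace ℝ (Fin 3), Set.BijOn Φ (Literature.MathematicalPhysics.StatisticalMechanics.barlowStacking 1 (Real.sqrt (2 / 3)) s) S ∧ ∀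 p ∈ Literature.MathematicalPhysics.StatisticalMechanics.barlowStacking 1 (Real.sqrt (2 / 3)) s, ∃ A : EuclideanSpace ℝ (Fin 3) →ₗᵢ[ℝ] EuclideanSpace ℝ (Fin 3), ∃ l : ℝ, 0 < l ∧ ∀ q ∈ Literature.MathematicalPhysics.StatisticalMechanics.barlowStacking 1 (Real.sqrt (2 / 3)) s, dist q p ≤ 1 → dist (Φ q) (Φ p + l • A (q - p)) ≤ 1 / 20 * l) → ∀ (c : EuclideanSpace ℝ (Fin 3)) (L : ℝ), 0 ≤ L → 2 * ((Literature.MathematicalPhysics.StatisticalMechanics.hcpPeriodicConfiguration ha hh).energyPerParticle Literature.MathematicalPhysics.StatisticalMechanics.lennardJones) * (({y : EuclideanSpace ℝ (Fin 3) | y ∈ S ∧ dist y c ≤ L} : Set (EuclideanSpace ℝ (Fin 3))).ncard : ℝ) + κ * (({y : EuclideanSpace ℝ (Fin 3) | y ∈ S ∧ dist y c ≤ L ∧ (¬ (let d : ℝ := sInf ((fun z => dist z y) '' (S \ {y})); let T : Set (EuclideanSpace ℝ (Fin 3)) := {z : EuclideanSpace ℝ (Fin 3) | z ∈ S ∧ z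 ≠ y ∧ dist z y < 13 / 10 * d}; ∃ A : EuclideanSpace ℝ (Fin 3) →ₗᵢ[ℝ] EuclideanSpace ℝ (Fin 3), ∃ e : ↥T ≃ ↥Literature.Geometry.DiscreteGeometry.fccKissingPattern, ∀ t : ↥T, dist (d⁻¹ • ((t : EuclideanSpace ℝ (Fin 3)) - y)) (A ((e t : ↥Literature.Geometry.DiscreteGeometry.fccKissingPattern) : EuclideanSpace ℝ (Fin 3))) ≤ 1 / 20) ∧ ¬ (let T : Set (EuclideanSpace ℝ (Fin 3)) := {z : EuclideanSpace ℝ (Fin 3) | z ∈ S ∧ z ≠ y ∧ dist z y < 13 / 10 * a}; let P : Set (EuclideanSpace ℝ (Fin 3)) := {p : EuclideanSpace ℝ (Fin 3) | p ∈ Literature.MathematicalPhysics.StatisticalMechanics.hcpStacking a h ∧ p ≠ 0 ∧ ‖p‖ < 13 / 10 * a}; ∃ A : EuclideanSpace ℝ (Fin 3) →ₗᵢ[ℝ] EuclideanSpace ℝ (Fin 3), ∃ e : ↥T ≃ ↥P, ∀ t : ↥T, dist ((t : EuclideanSpace ℝ (Fin 3)) - y) (A ((e t : ↥P) : EuclideanSpace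 ℝ (Fin 3))) ≤ η))} : Set (EuclideanSpace ℝ (Fin 3))).ncard : ℝ) - C * (L + 1) ^ 2 ≤ (∑' y : ↥{y : EuclideanSpace ℝ (Fin 3) | y ∈ S ∧ dist y c ≤ L}, (∑' z : ↥{z : EuclideanSpace ℝ (Fin 3) | z ∈ S ∧ z ≠ (y : EuclideanSpace ℝ (Fin 3))}, Literature.MathematicalPhysics.StatisticalMechanics.lennardJones (dist (y : EuclideanSpace ℝ (Fin 3)) (z : EuclideanSpace ℝ (Fin 3))))) := by
  intro a h ha hh hbox hmin δ hδ η hη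
  obtain ⟨henc, hglob⟩ := hR a h ha hh hbox hmin
  obtain ⟨θ, hθ, hgeo⟩ := hG a h ha hh henc.1 henc.2 δ hδ η hη
  obtain ⟨κ, hκ, C, hC⟩ := master_of stub_boundaryLayer hF hK a h ha hh henc hglob δ hδ θ hθ
    (fun S y => ¬ (let d : ℝ := sInf ((fun z => dist z y) '' (S \ {y})); let T : Set (EuclideanSpace ℝ (Fin 3)) := {z : EuclideanSpace ℝ (Fin 3) | z ∈ S ∧ z ≠ y ∧ dist z y < 13 / 10 * d}; ∃ A : EuclideanSpace ℝ (Fin 3) →ₗᵢ[ℝ] EuclideanSpace ℝ (Fin 3), ∃ e : ↥T ≃ ↥Literature.Geometry.DiscreteGeometry.fccKissingPattern, ∀ t : ↥T, dist (d⁻¹ • ((t : EuclideanSpace ℝ (Fin 3)) - y)) (A ((e t : ↥Literature.Geometry.DiscreteGeometry.fccKissingPattern) : EuclideanSpace ℝ (Fin 3))) ≤ 1 / 20) ∧ ¬ (let T : Set (EuclideanSpace ℝ (Fin 3)) := {z : EuclideanSpace ℝ (Fin 3) | z ∈ S ∧ z ≠ y ∧ dist z y < 13 / 10 * a}; let P :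 Set (EuclideanSpace ℝ (Fin 3)) := {p : EuclideanSpace ℝ (Fin 3) | p ∈ Literature.MathematicalPhysics.StatisticalMechanics.hcpStacking a h ∧ p ≠ 0 ∧ ‖p‖ < 13 / 10 * a}; ∃ A : EuclideanSpace ℝ (Fin 3) →ₗᵢ[ℝ] EuclideanSpace ℝ (Fin 3), ∃ e : ↥T ≃ ↥P, ∀ t : ↥T, dist ((t : EuclideanSpace ℝ (Fin 3)) - y) (A ((e t : ↥P) : EuclideanSpace ℝ (Fin 3))) ≤ η))
    (fun S hS y hy hGd hbad => hbad.2 (hgeo S hS y hy hGd).1)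
  refine ⟨κ, hκ, C, ?_⟩
  intro S hsep _hgood _htempl c L hL
  exact hC S hsep c L hL

/-- **Crux B from the glue and the two sibling cruxes**: rigidity of the box minimiser → shell geometry →
`HcpBulkFloor` (stmt-14477) → `HcpDefectCoercivity` (stmt-14476) → `HcpLandscapeGap`, the witness being the landed
box minimiser `stub_boxMinimiser`. [folklore] -/
theorem HcpLandscapeGap_of_glue : (∀ a h : ℝ, ∀ ha : a ≠ 0, ∀ hh : h ≠ 0, (9 / 10 < a ∧ a < 1 ∧ |h - a * Real.sqrt (2 / 3)| ≤ a / 100) → (∀ a' h' : ℝ, ∀ ha' : a' ≠ 0, ∀ hh' : h' ≠ 0, (9 / 10 < a' ∧ a' < 1 ∧ |h' - a' * Real.sqrt (2 / 3)| ≤ a' / 100) → (Literature.MathematicalPhysics.StatisticalMechanics.hcpPeriodicConfiguration ha hh).energyPerParticle Literature.MathematicalPhysics.StatisticalMechanics.lennardJones ≤ (Literature.MathematicalPhysics.StatisticalMechanics.hcpPeriodicConfiguration ha' hh').energyPerParticle Literature.MathematicalPhysics.StatisticalMechanics.lennardJones) → (|a - 97129 / 100000| ≤ 1 / 10000 ∧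 |h - 79294 / 100000| ≤ 1 / 10000) ∧ (∀ a' h' : ℝ, ∀ ha' : a' ≠ 0, ∀ hh' : h' ≠ 0, 0 < a' → 0 < h' → (Literature.MathematicalPhysics.StatisticalMechanics.hcpPeriodicConfiguration ha hh).energyPerParticle Literature.MathematicalPhysics.StatisticalMechanics.lennardJones ≤ (Literature.MathematicalPhysics.StatisticalMechanics.hcpPeriodicConfiguration ha' hh').energyPerParticle Literature.MathematicalPhysics.StatisticalMechanics.lennardJones)) → (∀ a h : ℝ, ∀ ha : a ≠ 0, ∀ hh : h ≠ 0, |a - 97129 / 100000| ≤ 1 / 10000 → |h - 79294 / 100000| ≤ 1 / 10000 → ∀ δ : ℝ, 0 < δ → ∀ η : ℝ, 0 < η → ∃ θ : ℝ, 0 < θ ∧ ∀ S : Set (EuclideanSpace ℝ (Fin 3)), (∀ y ∈ S, ∀ z ∈ S, y ≠ z → δ ≤ dist y z) → ∀ y ∈ S, (∃ A : EuclideanSpace ℝ (Fin 3) →ₗᵢ[ℝ] EuclideanSpace ℝ (Fin 3), (∀ p ∈ (Literature.MathematicalPhysics.StatisticalMechanics.hcpPeriodicConfiguration ha hh).points,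 ‖p‖ ≤ 4 → ∃ z ∈ S, dist z (y + A p) ≤ θ) ∧ (∀ z ∈ S, dist z y ≤ 4 → ∃ p ∈ (Literature.MathematicalPhysics.StatisticalMechanics.hcpPeriodicConfiguration ha hh).points, dist z (y + A p) ≤ θ)) → (let T : Set (EuclideanSpace ℝ (Fin 3)) := {z : EuclideanSpace ℝ (Fin 3) | z ∈ S ∧ z ≠ y ∧ dist z y < 13 / 10 * a}; let P : Set (EuclideanSpace ℝ (Fin 3)) := {p : EuclideanSpace ℝ (Fin 3) | p ∈ Literature.MathematicalPhysics.StatisticalMechanics.hcpStacking a h ∧ p ≠ 0 ∧ ‖p‖ < 13 / 10 * a}; ∃ A : EuclideanSpace ℝ (Fin 3) →ₗᵢ[ℝ] EuclideanSpace ℝ (Fin 3), ∃ e : ↥T ≃ ↥P, ∀ t : ↥T, dist ((t : EuclideanSpace ℝ (Fin 3)) - y) (A ((e t : ↥P) : EuclideanSpace ℝ (Fin 3))) ≤ η) ∧ ¬ (let d : ℝ := sInf ((fun z => dist z y) '' (S \ {y})); let T : Set (EuclideanSpace ℝ (Fin 3)) := {z : EuclideanSpace ℝ (Fin 3) | z ∈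 S ∧ z ≠ y ∧ dist z y < 13 / 10 * d}; ∃ A : EuclideanSpace ℝ (Fin 3) →ₗᵢ[ℝ] EuclideanSpace ℝ (Fin 3), ∃ e : ↥T ≃ ↥Literature.Geometry.DiscreteGeometry.fccKissingPattern, ∀ t : ↥T, dist (d⁻¹ • ((t : EuclideanSpace ℝ (Fin 3)) - y)) (A ((e t : ↥Literature.Geometry.DiscreteGeometry.fccKissingPattern) : EuclideanSpace ℝ (Fin 3))) ≤ 1 / 20)) → Summit.AtomisticToContinuum.Crystallization.Theses.HcpDefectCounting.HcpBulkFloor → Summit.AtomisticToContinuum.Crystallization.Theses.HcpDefectCounting.HcpDefectCoercivity → Summit.AtomisticToContinuum.Crystallization.Theses.HullExactificationCascade.HcpLandscapeGap :=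
  fun hR hG hF hK => HcpLandscapeGap_of_PNE stub_boxMinimiser (stackingFaultPrice_of_glue hR hG hF hK)
    (elasticCoercivity_of_glue hR hG hF hK)

end Summit.AtomisticToContinuum.Crystallization.Theorems.HcpLandscapeGapBirth
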